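import Literature.Probability.Process.ProgressiveDensity
import HarnessLib

/-!
# The Itô integral under a change of integrator version and under enlargement of the filtration

Topic `Probability/Process`; theorems only (no definition, no named fact).  Two robustness statements for the
tree's characterised Itô integral `IsItoIntegral H B J 𝓕 μ` (`ItoCalculus.lean`: `J 0 = 0`, a.s. continuous,
local martingale, and the u.c.p. limit of the elementary integrals along every approximating sequence of bounded
`𝓕`-simple processes), both needed when a stochastic integral has to be read on a LARGER filtration or against an
indistinguishable version of the driving Brownian motion (coupled pairs of SDEs on a common filtration; rotated
noises `∫ R dB` and their continuous modifications — `ItoIntegralRotation.lean`, `LevyCharacterisationVecModification.lean`):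

* `IsItoIntegral.congr_integrator_ae` — if `B' = B` at all times outside a null set, then `J = ∫ H dB` is also
  `∫ H dB'` (elementary integrals agree off the null set, so the u.c.p. statements are unchanged);
* `IsItoIntegral.exists_of_filtration_le` — if `𝓕 ≤ 𝓖`, `B` is a Brownian motion of `𝓖` in martingale form and
  `H` is `𝓖`-progressive with `E∫₀ᵗ H² < ∞`, then the `𝓖`-Itô integral `J' = ∫ H dB` (square-integrable `𝓖`-martingale
  version, `exists_isItoIntegral_of_sqErr_ne_top`) is indistinguishable from the `𝓕`-Itô integral `J`: both are
  u.c.p. limits along one `𝓕`-simple (hence `𝓖`-simple) approximating sequence (`TendstoUCP.ae_eq`).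

## References

* D. Revuz, M. Yor, *Continuous Martingales and Brownian Motion* (3rd ed., 1999), Ch. IV, Thm (2.2) and
  Prop. (2.13) (the stochastic integral as a limit in probability of elementary integrals; independence of the
  version).
-/

set_option autoImplicit false

noncomputable section

open MeasureTheory ProbabilityTheory Filter Topology
open scoped NNReal ENNReal

namespace Literature.Probability.Process

variable {Ω : Type*} {m : MeasurableSpace Ω} {μ : Measure Ω} {𝓕 𝓖 : Filtration ℝ≥0 m}
  {H B B' J : ℝ≥0 → Ω → ℝ}

/-- Elementary integrals against two versions of the integrator agree wherever the versions agree at all times.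
[folklore] -/
private theorem SimpleProcess.integral_congr_of_eq (K : SimpleProcess m 𝓕) {ω : Ω} (h : ∀ t, B' t ω = B t ω)
    (s : ℝ≥0) : K.integral B' s ω = K.integral B s ω := by
  simp only [SimpleProcess.integral, h]

/-- u.c.p. convergence of elementary integrals is unchanged when the integrator is replaced by an indistinguishable
version. [folklore] -/
private theorem tendstoUCP_integral_congr_ae (Hn : ℕ → SimpleProcess m 𝓕) (hBB' : ∀ᵐ ω ∂μ, ∀ t, B' t ω = B t ω)
    (hJ : TendstoUCP (fun n ↦ (Hn n).integral B) J μ) : TendstoUCP (fun n ↦ (Hn n).integral B') J μ := by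
  intro t ε hε
  have hset : ∀ n, {ω | ∃ s ≤ t, ε ≤ |(Hn n).integral B' s ω - J s ω|} =ᵐ[μ]
      {ω | ∃ s ≤ t, ε ≤ |(Hn n).integral B s ω - J s ω|} := by
    intro n
    refine Filter.eventuallyEq_set.2 ?_
    filter_upwards [hBB'] with ω hω
    simp only [SimpleProcess.integral_congr_of_eq (Hn n) hω]
  simp_rw [measure_congr (hset _)]
  exact hJ t ε hε

/-- **Change of integrator version.**  If `B'` and `B` are indistinguishable (`B' = B` at all times, a.s.), an
Itô integral against `B` is an Itô integral against `B'` (same integrand, same process, same filtration).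
[cite: RevuzYor1999, Ch. IV Thm (2.2)] -/
theorem IsItoIntegral.congr_integrator_ae (hJ : IsItoIntegral H B J 𝓕 μ) (hBB' : ∀ᵐ ω ∂μ, ∀ t, B' t ω = B t ω) :
    IsItoIntegral H B' J 𝓕 μ :=
  ⟨hJ.1, hJ.2.1, hJ.2.2.1, hJ.2.2.2.1, fun Hn hHn ↦ tendstoUCP_integral_congr_ae Hn hBB' (hJ.2.2.2.2 Hn hHn)⟩

/-- **Enlargement of the filtration.**  Let `𝓕 ≤ 𝓖` be filtrations, `B` a continuous square-integrable
`𝓖`-martingale with `B² - t` a `𝓖`-martingale (a Brownian motion of `𝓖` in martingale form), `H` a `𝓖`-progressive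
integrand with `E∫₀ᵗ H² < ∞`, and `J = ∫ H dB` an Itô integral w.r.t. `𝓕`.  Then the square-integrable `𝓖`-martingale
version `J'` of `∫ H dB` w.r.t. `𝓖` is indistinguishable from `J`. [cite: RevuzYor1999, Ch. IV Prop. (2.13)] -/
theorem IsItoIntegral.exists_of_filtration_le [IsProbabilityMeasure μ] (hle : ∀ t, 𝓕 t ≤ 𝓖 t)
    (hJ : IsItoIntegral H B J 𝓕 μ) (hB : Martingale B 𝓖 μ)
    (hBsq : Martingale (fun t ω ↦ B t ω ^ 2 - (t : ℝ)) 𝓖 μ) (hB2 : ∀ t, MemLp (B t) 2 μ)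
    (hBc : ∀ ω, Continuous (B · ω)) (hH : IsStronglyProgressive 𝓖 H) (hfin : ∀ t : ℝ≥0, sqErr H 0 μ t ≠ ∞) :
    ∃ J' : ℝ≥0 → Ω → ℝ, IsItoIntegral H B J' 𝓖 μ ∧ Martingale J' 𝓖 μ ∧ (∀ t, MemLp (J' t) 2 μ) ∧
      ∀ᵐ ω ∂μ, ∀ t, J' t ω = J t ω := by
  obtain ⟨J', hJ', hJ'M, hJ'2, -⟩ := exists_isItoIntegral_of_sqErr_ne_top hB hBsq hB2 hBc hH hfin
  obtain ⟨Hn, hHn⟩ := hJ.2.2.2.1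
  -- the same simple processes, read as `𝓖`-simple processes
  let Gn : ℕ → SimpleProcess m 𝓖 := fun n ↦
    ⟨(Hn n).times, (Hn n).sorted, (Hn n).value, fun i h ↦ ((Hn n).measurable i h).mono (hle _), (Hn n).bounded⟩
  have hto : ∀ n, (Gn n).toProcess = (Hn n).toProcess := fun n ↦ rfl
  have hint : ∀ n, (Gn n).integral B = (Hn n).integral B := fun n ↦ rfl
  have hGnA : SimpleProcess.IsApproxSeq Gn H μ := by
    intro t ε hε
    simp_rw [hto]
    exact hHn t ε hε
  have h1 : TendstoUCP (fun n ↦ (Hn n).integral B) J μ := hJ.2.2.2.2 Hn hHn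
  have h2 : TendstoUCP (fun n ↦ (Hn n).integral B) J' μ := by
    have h := hJ'.2.2.2.2 Gn hGnA
    simp_rw [hint] at h
    exact h
  exact ⟨J', hJ', hJ'M, hJ'2, TendstoUCP.ae_eq h2 h1⟩

/-- **Enlargement of the filtration, martingale form of the conclusion**: under the hypotheses of
`IsItoIntegral.exists_of_filtration_le`, if moreover `J` itself is `𝓖`-adapted (e.g. `𝓕`-adapted), then `J` is a
square-integrable `𝓖`-martingale (it is a modification of the `𝓖`-martingale version). [cite: RevuzYor1999, Ch. IV Thm (2.2)] -/
theorem IsItoIntegral.martingale_of_filtration_le [IsProbabilityMeasure μ] (hle : ∀ t, 𝓕 t ≤ 𝓖 t)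
    (hJ : IsItoIntegral H B J 𝓕 μ) (hB : Martingale B 𝓖 μ)
    (hBsq : Martingale (fun t ω ↦ B t ω ^ 2 - (t : ℝ)) 𝓖 μ) (hB2 : ∀ t, MemLp (B t) 2 μ)
    (hBc : ∀ ω, Continuous (B · ω)) (hH : IsStronglyProgressive 𝓖 H) (hfin : ∀ t : ℝ≥0, sqErr H 0 μ t ≠ ∞)
    (hJa : StronglyAdapted 𝓖 J) :
    Martingale J 𝓖 μ ∧ ∀ t, MemLp (J t) 2 μ := by
  obtain ⟨J', -, hJ'M, hJ'2, hae⟩ := hJ.exists_of_filtration_le hle hB hBsq hB2 hBc hH hfin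
  have haet : ∀ t, J' t =ᵐ[μ] J t := fun t ↦ hae.mono fun ω hω ↦ hω t
  exact ⟨hJ'M.congr hJa haet, fun t ↦ (hJ'2 t).ae_eq (haet t)⟩

end Literature.Probability.Process

end
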